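import Mathlib
import HarnessLib

/-!
# `DensityLadder.SeparatedTowerDensityLine` (item stmt-RiemannHypothesis-24918) — bounds for the
# window transform `ĉ_ρ(η) = ∫_{-1}^{1} φ(v)(1+ηv)^{ρ−1} dv`

LINE L57 «sieve sight above the density line» (rh-idea-10 g1), crux K1 `SeparatedTowerDensityLine`,
stub S1 of the registered skeleton `Birth.lean`, step (c) of the mean-value argument (seat memo
`MEANVALUE-SECOND-READ.md`, evidence on stmt-RiemannHypothesis-24918):
* (c1) the trivial bound `‖ĉ_ρ(η)‖ ≤ 4 sup|φ|` for `0 ≤ Re ρ ≤ 1`, `0 < η ≤ 1/2`;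
* (c3) the lower bound `Re ĉ_ρ(η) ≥ (7/16) ∫φ` for `φ ≥ 0`, `0 ≤ Re ρ ≤ 1` and `η(1+|Im ρ|) ≤ 1/4`
  (on the window `|log(1+ηv)| ≤ 2η`, so `(1+ηv)^{ρ−1} = e^{w}` with `|Re w|, |Im w| ≤ 1/2` and
  `Re e^{w} ≥ e^{−1/2} cos(1/2) ≥ 7/16`) — this is where `φ ≥ 0` is used, and it is what makes the
  tower's diagonal terms with `|γ| ≤ T/4 − 1` visible at height `T = 1/η`.
Cell rh-split, seat rh-split-prover-l57 g0.  RH-free, ζ-free; FRONTIER bookkeeping; nothing here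
bears on the truth of RH.
-/

set_option linter.dupNamespace false

noncomputable section

open Complex Filter Set MeasureTheory Topology
open scoped Real

namespace Summit.RiemannHypothesis.RiemannHypothesis.Theorems.DensityLadderSeparatedTowerTransform

/-- On the window: `‖(1+ηv)^{ρ−1}‖ ≤ 2` for `v ∈ [−1,1]`, `0 < η ≤ 1/2`, `0 ≤ Re ρ ≤ 1`. [folklore] -/
theorem norm_base_cpow_le {η v : ℝ} (hη : 0 < η) (hη1 : η ≤ 1 / 2) (hv : v ∈ Icc (-1 : ℝ) 1)
    {ρ : ℂ} (h0 : 0 ≤ ρ.re) (h1 : ρ.re ≤ 1) :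
    ‖((1 : ℂ) + (η : ℂ) * (v : ℂ)) ^ (ρ - 1)‖ ≤ 2 := by
  rw [mem_Icc] at hv
  have hpos : 0 < 1 + η * v := by nlinarith
  have hge : 1 / 2 ≤ 1 + η * v := by nlinarith
  have hb : ((1 : ℂ) + (η : ℂ) * (v : ℂ)) = ((1 + η * v : ℝ) : ℂ) := by push_cast; ring
  rw [hb, Complex.norm_cpow_eq_rpow_re_of_pos hpos]
  have hre : (ρ - 1).re = ρ.re - 1 := by simp
  rw [hre]
  calc (1 + η * v) ^ (ρ.re - 1) ≤ (1 / 2 : ℝ) ^ (ρ.re - 1) :=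
        Real.rpow_le_rpow_of_nonpos (by norm_num) hge (by linarith)
    _ = (2 : ℝ) ^ (1 - ρ.re) := by
        rw [one_div, Real.inv_rpow (by norm_num), ← Real.rpow_neg (by norm_num)]; ring_nf
    _ ≤ (2 : ℝ) ^ (1 : ℝ) := Real.rpow_le_rpow_of_exponent_le (by norm_num) (by linarith)
    _ = 2 := Real.rpow_one 2

/-- **(c1) Trivial bound for the window transform**: `‖∫_{-1}^{1} φ(v)(1+ηv)^{ρ−1} dv‖ ≤ 4 sup|φ|`
for `0 ≤ Re ρ ≤ 1`, `0 < η ≤ 1/2`. [folklore] -/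
theorem norm_windowTransform_le (φ : ℝ → ℝ) {M : ℝ} (hM : ∀ v, |φ v| ≤ M) {η : ℝ} (hη : 0 < η)
    (hη1 : η ≤ 1 / 2) {ρ : ℂ} (h0 : 0 ≤ ρ.re) (h1 : ρ.re ≤ 1) :
    ‖∫ v in (-1 : ℝ)..1, (φ v : ℂ) * ((1 : ℂ) + (η : ℂ) * (v : ℂ)) ^ (ρ - 1)‖ ≤ 4 * M := by
  have hM0 : 0 ≤ M := (abs_nonneg _).trans (hM 0)
  have h := intervalIntegral.norm_integral_le_of_norm_le_const (a := (-1 : ℝ)) (b := 1)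
    (C := M * 2) (f := fun v ↦ (φ v : ℂ) * ((1 : ℂ) + (η : ℂ) * (v : ℂ)) ^ (ρ - 1)) fun v hv ↦ by
      rw [uIoc_of_le (by norm_num), mem_Ioc] at hv
      rw [norm_mul, Complex.norm_real, Real.norm_eq_abs]
      exact mul_le_mul (hM v) (norm_base_cpow_le hη hη1 ⟨hv.1.le, hv.2⟩ h0 h1) (norm_nonneg _) hM0
  calc _ ≤ M * 2 * |1 - (-1 : ℝ)| := h
    _ = 4 * M := by norm_num; ring

/-- On the window `|log(1+ηv)| ≤ 2η` (`v ∈ [−1,1]`, `0 < η ≤ 1/2`). [folklore] -/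
theorem abs_log_base_le {η v : ℝ} (hη : 0 < η) (hη1 : η ≤ 1 / 2) (hv : v ∈ Icc (-1 : ℝ) 1) :
    |Real.log (1 + η * v)| ≤ 2 * η := by
  rw [mem_Icc] at hv
  have hpos : 0 < 1 + η * v := by nlinarith
  rw [abs_le]
  constructor
  · have h := Real.one_sub_inv_le_log_of_pos hpos
    have hinv : (1 + η * v)⁻¹ ≤ 1 + 2 * η := by
      rw [inv_eq_one_div, div_le_iff₀ hpos]
      nlinarith [mul_nonneg hη.le (show 0 ≤ v + 1 by linarith),
        mul_nonneg hη.le (show 0 ≤ 1 / 2 - η by linarith)]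
    linarith
  · have h := Real.log_le_sub_one_of_pos hpos
    nlinarith

/-- On the window, the real part of `(1+ηv)^{ρ−1}` is at least `7/16` whenever `0 ≤ Re ρ ≤ 1` and
`η(1 + |Im ρ|) ≤ 1/4`. [folklore] -/
theorem re_base_cpow_ge {η v : ℝ} (hη : 0 < η) (hη1 : η ≤ 1 / 2) (hv : v ∈ Icc (-1 : ℝ) 1)
    {ρ : ℂ} (h0 : 0 ≤ ρ.re) (h1 : ρ.re ≤ 1) (hγ : η * (1 + |ρ.im|) ≤ 1 / 4) :
    7 / 16 ≤ (((1 : ℂ) + (η : ℂ) * (v : ℂ)) ^ (ρ - 1)).re := by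
  have hv' := hv
  rw [mem_Icc] at hv
  have hpos : 0 < 1 + η * v := by nlinarith
  have hb : ((1 : ℂ) + (η : ℂ) * (v : ℂ)) = ((1 + η * v : ℝ) : ℂ) := by push_cast; ring
  rw [hb, Complex.cpow_def_of_ne_zero (by exact_mod_cast hpos.ne'), ← Complex.ofReal_log hpos.le,
    Complex.exp_re]
  set L : ℝ := Real.log (1 + η * v) with hL
  have hLb : |L| ≤ 2 * η := abs_log_base_le hη hη1 hv'
  have hη4 : η ≤ 1 / 4 := by nlinarith [abs_nonneg ρ.im]
  -- real and imaginary parts of the exponent `w = L (ρ - 1)`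
  have hwre : ((L : ℂ) * (ρ - 1)).re = L * (ρ.re - 1) := by simp
  have hwim : ((L : ℂ) * (ρ - 1)).im = L * ρ.im := by simp
  rw [hwre, hwim]
  have hre_abs : |L * (ρ.re - 1)| ≤ 1 / 2 := by
    rw [abs_mul]
    have : |ρ.re - 1| ≤ 1 := abs_le.2 ⟨by linarith, by linarith⟩
    calc |L| * |ρ.re - 1| ≤ 2 * η * 1 := mul_le_mul hLb this (abs_nonneg _) (by positivity)
      _ ≤ 1 / 2 := by linarith
  have him_abs : |L * ρ.im| ≤ 1 / 2 := by
    rw [abs_mul]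
    calc |L| * |ρ.im| ≤ 2 * η * |ρ.im| := mul_le_mul_of_nonneg_right hLb (abs_nonneg _)
      _ ≤ 1 / 2 := by nlinarith [abs_nonneg ρ.im]
  -- `e^{Re w} ≥ 1/2` and `cos(Im w) ≥ 7/8`
  have hexp : 1 / 2 ≤ Real.exp (L * (ρ.re - 1)) := by
    have h := Real.add_one_le_exp (L * (ρ.re - 1))
    have := (abs_le.1 hre_abs).1
    linarith
  have hcos : 7 / 8 ≤ Real.cos (L * ρ.im) := by
    have h := Real.one_sub_sq_div_two_le_cos (x := L * ρ.im)
    have hsq : (L * ρ.im) ^ 2 ≤ 1 / 4 := by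
      have := abs_le.1 him_abs
      nlinarith
    linarith
  calc (7 / 16 : ℝ) = 1 / 2 * (7 / 8) := by norm_num
    _ ≤ Real.exp (L * (ρ.re - 1)) * Real.cos (L * ρ.im) :=
        mul_le_mul hexp hcos (by norm_num) (Real.exp_pos _).le

/-- The window integrand is continuous on `[−1, 1]` (the base `1 + ηv` stays in the slit plane).
[folklore] -/
theorem continuousOn_windowIntegrand (φ : ℝ → ℝ) (hφc : Continuous φ) {η : ℝ} (hη : 0 < η)
    (hη1 : η ≤ 1 / 2) (ρ : ℂ) :
    ContinuousOn (fun v : ℝ ↦ (φ v : ℂ) * ((1 : ℂ) + (η : ℂ) * (v : ℂ)) ^ (ρ - 1)) (uIcc (-1 : ℝ) 1) := by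
  intro v hv
  rw [uIcc_of_le (by norm_num), mem_Icc] at hv
  have hpos : 0 < 1 + η * v := by nlinarith
  refine ContinuousAt.continuousWithinAt ?_
  refine ((Complex.continuous_ofReal.comp hφc).continuousAt).mul ?_
  refine ContinuousAt.cpow (by fun_prop) continuousAt_const ?_
  rw [Complex.mem_slitPlane_iff]
  left
  simp only [add_re, one_re, mul_re, ofReal_re, ofReal_im, mul_zero, sub_zero]
  exact hpos

/-- **(c3) Lower bound for the window transform**: for `φ ≥ 0` continuous, `0 < η ≤ 1/2`,
`0 ≤ Re ρ ≤ 1` and `η(1 + |Im ρ|) ≤ 1/4`,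
`(7/16) ∫_{-1}^{1} φ ≤ Re ∫_{-1}^{1} φ(v)(1+ηv)^{ρ−1} dv`. [folklore] -/
theorem re_windowTransform_ge (φ : ℝ → ℝ) (hφc : Continuous φ) (hφ0 : ∀ v, 0 ≤ φ v) {η : ℝ}
    (hη : 0 < η) (hη1 : η ≤ 1 / 2) {ρ : ℂ} (h0 : 0 ≤ ρ.re) (h1 : ρ.re ≤ 1)
    (hγ : η * (1 + |ρ.im|) ≤ 1 / 4) :
    7 / 16 * (∫ v in (-1 : ℝ)..1, φ v) ≤
      (∫ v in (-1 : ℝ)..1, (φ v : ℂ) * ((1 : ℂ) + (η : ℂ) * (v : ℂ)) ^ (ρ - 1)).re := by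
  have hint : IntervalIntegrable (fun v : ℝ ↦ (φ v : ℂ) * ((1 : ℂ) + (η : ℂ) * (v : ℂ)) ^ (ρ - 1))
      volume (-1 : ℝ) 1 := (continuousOn_windowIntegrand φ hφc hη hη1 ρ).intervalIntegrable
  have hre := intervalIntegral.intervalIntegral_re hint
  -- `Re ∫ = ∫ Re`
  rw [show (∫ v in (-1 : ℝ)..1, (φ v : ℂ) * ((1 : ℂ) + (η : ℂ) * (v : ℂ)) ^ (ρ - 1)).re =
      ∫ v in (-1 : ℝ)..1, ((φ v : ℂ) * ((1 : ℂ) + (η : ℂ) * (v : ℂ)) ^ (ρ - 1)).re from hre.symm,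
    ← intervalIntegral.integral_const_mul]
  refine intervalIntegral.integral_mono_on (by norm_num) ?_ ?_ fun v hv ↦ ?_
  · exact (hφc.intervalIntegrable _ _).const_mul _
  · exact (RCLike.reCLM (K := ℂ)).continuous.comp_continuousOn
      (continuousOn_windowIntegrand φ hφc hη hη1 ρ) |>.intervalIntegrable
  · have h := re_base_cpow_ge hη hη1 hv h0 h1 hγ
    rw [Complex.re_ofReal_mul]
    calc 7 / 16 * φ v = φ v * (7 / 16) := by ring
      _ ≤ φ v * (((1 : ℂ) + (η : ℂ) * (v : ℂ)) ^ (ρ - 1)).re :=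
          mul_le_mul_of_nonneg_left h (hφ0 v)

end Summit.RiemannHypothesis.RiemannHypothesis.Theorems.DensityLadderSeparatedTowerTransform

end
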